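import Literature.AlgebraicGeometry.Motives.TateClassesGaloisActionFiniteQuotient
import Mathlib.RepresentationTheory.Maschke
import HarnessLib

/-!
# Over any (perfect) field, `Γ_k` acts on the Tate classes through a finite quotient: the image of `Γ_k` in
# `GL(𝒯ᵖ(X))` is finite, every `χ(g)ᵖρ(g)|𝒯ᵖ(X)` has finite order, and the `Γ_k`-module `𝒯ᵖ(X)` is
# semisimple

Topic `Literature/AlgebraicGeometry/Motives`; THEOREMS ONLY (no definition, no instance, no named
fact; D-0026).

J. Tate, *Conjectures on algebraic cycles in ℓ-adic cohomology* (1994) §1 takes the Tate classes to be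
the classes of `H^{2p}(X)(p)` fixed by an OPEN subgroup of `Γ_k = Gal(k̄/k)` (the tree's
`GaloisWeilCohomology.tateClasses = smoothInvariants`).  P. Deligne, *Hodge cycles on abelian
varieties*, LNM 900 (1982), Prop. 2.9(b): the Galois group acts on the (finite-dimensional) space of
absolute Hodge cycles «through a finite quotient» — the argument being that each class is fixed by an
open subgroup, a finite-dimensional space of such classes is fixed by ONE open subgroup (row g39-#1
`exists_openSubgroup_tateClasses_eq_invariants`), and an open subgroup of the compact group `Γ_k`
has finite index.  B. Kahn (2020) Warning 5.9 (held, p. 89): over `ℂ` continuous representations of a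
profinite group factor through a finite quotient; J.-P. Serre, *Linear representations of finite
groups* §1.3 Th. 1: representations of a finite group in characteristic `0` are completely reducible
(Maschke).

Rows g39-#1/#2 proved the consequences over a FINITE field through the Frobenius.  This file proves the
`Γ`-STRUCTURAL consequences over any PERFECT field `k` (finite fields, number fields, …) for the tree's
abstract `E : GaloisWeilCohomology k K χ` (no continuity of `ρ`; `Γ_k` compact by Mathlib's Krull
topology, which needs `k̄/k` Galois, i.e. `k` perfect):

* §1 (pure: `ρ` a representation of a COMPACT topological group `Γ` on a `K`-space `V`, no
  continuity) on the vectors fixed by an open subgroup `U`: every `ρ(g)` has finite order there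
  (`exists_pow_apply_eq_of_mem_invariants_openSubgroup`, Mathlib `Subgroup.exists_pow_mem_of_index_ne_zero`)
  and is semisimple on any `ρ(g)`-stable `T ≤ V^U` (char `0`); the map `g ↦ ρ(g)|T` is constant on the
  cosets `gU`, so **its image is finite** (`finite_range_restrict_of_le_invariants_openSubgroup`); the
  pointwise stabiliser of a `Γ`-stable `T ≤ V^U` is an OPEN NORMAL subgroup
  (`exists_openSubgroup_normal_forall_apply_eq`); **Maschke for a finite image**: a representation
  whose image in `End(V)` is finite is semisimple (a private copy of the tree's
  `Representation.isSemisimpleRepresentation_of_finite_range_asGroupHom`, to avoid the heavy import), hence the subrepresentation on a `Γ`-stable `T ≤ V^U` is semisimple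
  (`isSemisimpleRepresentation_toRepresentation_of_le_invariants_openSubgroup`).
* §2 (`E`, any PERFECT field `k` — so that Mathlib knows `Γ_k` compact —, `X` smooth projective) **`Γ_k` acts on `𝒯ᵖ(X)` through a finite quotient**:
  an open NORMAL subgroup acts trivially (`exists_openSubgroup_normal_tateClasses_eq_invariants`), every
  `χ(g)ᵖρ(g)` has finite order on `𝒯ᵖ(X)` and is semisimple there (char `K` = 0;
  `isSemisimple_restrict_ρTwist_tateClasses_of_field`, extending row g39-#1 beyond finite fields),
  **the image of `Γ_k` in `End(𝒯ᵖ(X))` is finite** (`finite_range_restrict_ρTwist_tateClasses_of_field`)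
  and **the `Γ_k`-module `𝒯ᵖ(X)` is semisimple** (`isSemisimpleRepresentation_tateClasses_of_field`,
  extending row g39-#2); every `Γ_k`-stable subspace of `𝒯ᵖ(X)` has a `Γ_k`-stable complement
  (`exists_galois_stable_compl_of_le_tateClasses_of_field`).

What this file does NOT do: no statement about classes outside `𝒯ᵖ(X)`; nothing on `T^p`.  HC is not
touched.

## Provenance

Lane `lit-hodgefound` (summit `HodgeConjecture`, Track 2 foundations library, Layer B: motives),
seat `lit-hodgefound-p29` (literature-prover, generation 39, row g39-#4).
-/

universe u v w

open CategoryTheory AlgebraicGeometry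

noncomputable section

namespace Literature.AlgebraicGeometry.Motives

/-! ## §1 Representations of a compact group on the vectors fixed by an open subgroup (pure) -/

section Pure

variable {K : Type v} [Field K] {V : Type w} [AddCommGroup V] [Module K V]
variable {Γ : Type*} [Group Γ] [TopologicalSpace Γ] [IsTopologicalGroup Γ] [CompactSpace Γ]

/-- An open subgroup of a compact group has finite (non-zero) index. [cite: SerreLocalFields1979, Ch. XIII §1]
[cite: Deligne1982HodgeCycles, §2 Prop. 2.9(b)] -/
theorem index_ne_zero_of_openSubgroup_of_compactSpace (U : OpenSubgroup Γ) :
    (U : Subgroup Γ).index ≠ 0 := by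
  haveI : Finite (Γ ⧸ (U : Subgroup Γ)) := Subgroup.quotient_finite_of_isOpen _ U.isOpen
  haveI : (U : Subgroup Γ).FiniteIndex := Subgroup.finiteIndex_of_finite_quotient
  exact Subgroup.FiniteIndex.index_ne_zero

/-- **On `V^U` every `ρ(g)` has finite order**: some `gⁿ`, `1 ≤ n ≤ [Γ : U]`, lies in the open subgroup
`U` (compact `Γ`; no normality, no continuity of `ρ`). [cite: Deligne1982HodgeCycles, §2 Prop. 2.9(b)]
[cite: Tate1994, §1] -/
theorem exists_pow_apply_eq_of_mem_invariants_openSubgroup (ρ : Representation K Γ V)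
    (U : OpenSubgroup Γ) (g : Γ) :
    ∃ n : ℕ, 0 < n ∧ ∀ v ∈ Representation.invariants (ρ.comp (U : Subgroup Γ).subtype),
      (ρ g ^ n) v = v := by
  obtain ⟨n, hn, -, hmem⟩ :=
    (U : Subgroup Γ).exists_pow_mem_of_index_ne_zero (index_ne_zero_of_openSubgroup_of_compactSpace U) g
  exact ⟨n, hn, fun v hv ↦ by rw [← map_pow]; exact hv ⟨_, hmem⟩⟩

/-- **Every `ρ(g)` is a semisimple endomorphism of any `ρ(g)`-stable `T ≤ V^U`** (compact `Γ`, char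
`K` = 0, no continuity): it has finite order there. [cite: Serre1977, §1.3 Thm. 1]
[cite: Deligne1982HodgeCycles, §2 Prop. 2.9(b)] -/
theorem isSemisimple_restrict_of_le_invariants_openSubgroup [CharZero K] (ρ : Representation K Γ V)
    (U : OpenSubgroup Γ) (g : Γ) {T : Submodule K V}
    (hT : T ≤ Representation.invariants (ρ.comp (U : Subgroup Γ).subtype))
    (hg : ∀ v ∈ T, ρ g v ∈ T) : Module.End.IsSemisimple ((ρ g).restrict hg) := by
  obtain ⟨n, hn, h⟩ := exists_pow_apply_eq_of_mem_invariants_openSubgroup ρ U g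
  refine Literature.RepresentationTheory.FiniteGroups.TracePow.isSemisimple_of_pow_eq_one
    (N := n) (Nat.cast_ne_zero.mpr hn.ne') ?_
  rw [Module.End.pow_restrict]
  ext ⟨v, hv⟩
  rw [LinearMap.coe_restrict_apply, Module.End.one_apply]
  exact h v (hT hv)

omit [IsTopologicalGroup Γ] [CompactSpace Γ] in
/-- `ρ(gu)` and `ρ(g)` agree on `V^U` for `u ∈ U`. [cite: Deligne1982HodgeCycles, §2 Prop. 2.9(b)] -/
theorem apply_mul_eq_of_mem_invariants_openSubgroup (ρ : Representation K Γ V) (U : OpenSubgroup Γ)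
    (g : Γ) {u : Γ} (hu : u ∈ (U : Subgroup Γ)) {v : V}
    (hv : v ∈ Representation.invariants (ρ.comp (U : Subgroup Γ).subtype)) :
    ρ (g * u) v = ρ g v := by
  have huv : ρ u v = v := hv ⟨u, hu⟩
  rw [map_mul, Module.End.mul_apply, huv]

/-- **The image of `Γ` in `End(T)` is finite** for a `Γ`-stable `T ≤ V^U`: the map `g ↦ ρ(g)|T` is
constant on the finitely many cosets `gU` (compact `Γ`, `U` open; no continuity of `ρ`). [cite: Deligne1982HodgeCycles, §2 Prop. 2.9(b) «through a finite quotient»]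
[cite: Kahn2020, §5 Warning 5.9] -/
theorem finite_range_restrict_of_le_invariants_openSubgroup (ρ : Representation K Γ V)
    (U : OpenSubgroup Γ) {T : Submodule K V}
    (hT : T ≤ Representation.invariants (ρ.comp (U : Subgroup Γ).subtype))
    (hst : ∀ g : Γ, ∀ v ∈ T, ρ g v ∈ T) :
    (Set.range fun g : Γ ↦ (ρ g).restrict (hst g)).Finite := by
  classical
  haveI : Finite (Γ ⧸ (U : Subgroup Γ)) := Subgroup.quotient_finite_of_isOpen _ U.isOpen
  -- `ρ(g)|T` only depends on the coset `gU`: compare with the chosen representative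
  have key : ∀ g : Γ, (ρ g).restrict (hst g) =
      (ρ (QuotientGroup.mk g : Γ ⧸ (U : Subgroup Γ)).out).restrict (hst _) := fun g ↦ by
    obtain ⟨u, hu⟩ := QuotientGroup.mk_out_eq_mul (U : Subgroup Γ) g
    ext ⟨v, hv⟩
    rw [LinearMap.coe_restrict_apply, LinearMap.coe_restrict_apply, hu,
      apply_mul_eq_of_mem_invariants_openSubgroup ρ U g u.2 (hT hv)]
  refine (Set.finite_range fun q : Γ ⧸ (U : Subgroup Γ) ↦ (ρ q.out).restrict (hst _)).subset ?_
  rintro _ ⟨g, rfl⟩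
  exact ⟨QuotientGroup.mk g, (key g).symm⟩

omit [CompactSpace Γ] in
/-- **The pointwise stabiliser of a `Γ`-stable `T ≤ V^U` is an open normal subgroup** acting trivially
on `T` (`U` open; for compact `Γ` the quotient `Γ/U'` through which `Γ` acts on `T` is finite).
[cite: Deligne1982HodgeCycles, §2 Prop. 2.9(b) «through a finite quotient»] [cite: Tate1994, §1] -/
theorem exists_openSubgroup_normal_forall_apply_eq (ρ : Representation K Γ V) (U : OpenSubgroup Γ)
    {T : Submodule K V} (hT : T ≤ Representation.invariants (ρ.comp (U : Subgroup Γ).subtype))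
    (hst : ∀ g : Γ, ∀ v ∈ T, ρ g v ∈ T) :
    ∃ U' : OpenSubgroup Γ, (U' : Subgroup Γ).Normal ∧ U ≤ U' ∧
      ∀ g : Γ, g ∈ U' ↔ ∀ v ∈ T, ρ g v = v := by
  -- the pointwise stabiliser as a subgroup
  let S : Subgroup Γ :=
    { carrier := {g | ∀ v ∈ T, ρ g v = v}
      mul_mem' := fun {a b} ha hb v hv ↦ by
        rw [map_mul, Module.End.mul_apply, hb v hv, ha v hv]
      one_mem' := fun v _ ↦ by rw [map_one, Module.End.one_apply]
      inv_mem' := fun {a} ha v hv ↦ by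
        have h := ha v hv
        calc ρ a⁻¹ v = ρ a⁻¹ (ρ a v) := by rw [h]
          _ = v := by rw [← Module.End.mul_apply, ← map_mul, inv_mul_cancel, map_one,
                Module.End.one_apply] }
  have hUS : (U : Subgroup Γ) ≤ S := fun u hu v hv ↦ (hT hv) ⟨u, hu⟩
  have hSopen : IsOpen (S : Set Γ) := Subgroup.isOpen_of_openSubgroup S hUS
  refine ⟨⟨S, hSopen⟩, ⟨fun s hs g v hv ↦ ?_⟩, hUS, fun g ↦ Iff.rfl⟩
  -- normality: `ρ(g s g⁻¹) v = ρ(g) ρ(s) (ρ(g⁻¹) v)` and `ρ(g⁻¹) v ∈ T`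
  have h1 : ρ g⁻¹ v ∈ T := hst g⁻¹ v hv
  rw [map_mul, map_mul, Module.End.mul_apply, Module.End.mul_apply, hs _ h1,
    ← Module.End.mul_apply, ← map_mul, mul_inv_cancel, map_one, Module.End.one_apply]

omit [TopologicalSpace Γ] [IsTopologicalGroup Γ] [CompactSpace Γ] in
/-- **Maschke for a finite image**: a representation of any group `Γ` over a field of characteristic
`0` whose image in `End(V)` is finite is semisimple — its subrepresentations are those of the finite
group `ρ(Γ) ≤ GL(V)`, to which Mathlib's Maschke theorem applies.  (The tree's
`Literature.NumberTheory.GaloisRepresentations.Representation.isSemisimpleRepresentation_of_finite_range_asGroupHom`,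
a PRIVATE local copy to keep the imports of this file inside `Motives`.) [cite: Serre1977, §1.3 Thm. 1] -/
private theorem isSemisimpleRepresentation_of_finite_range [CharZero K] (ρ : Representation K Γ V)
    (hfin : (Set.range fun g : Γ ↦ ρ g).Finite) : ρ.IsSemisimpleRepresentation := by
  let H : Subgroup (V →ₗ[K] V)ˣ := ρ.asGroupHom.range
  have hfin' : (Set.range ρ.asGroupHom).Finite := by
    refine Set.Finite.of_finite_image (f := (Units.val : (V →ₗ[K] V)ˣ → V →ₗ[K] V)) ?_
      Units.val_injective.injOn
    refine hfin.subset ?_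
    rintro _ ⟨_, ⟨g, rfl⟩, rfl⟩
    exact ⟨g, (ρ.asGroupHom_apply g).symm⟩
  haveI : Finite H := by
    have h : (H : Set (V →ₗ[K] V)ˣ).Finite := by rw [MonoidHom.coe_range]; exact hfin'
    exact h.to_subtype
  haveI : NeZero (Nat.card H : K) := ⟨Nat.cast_ne_zero.mpr Nat.card_pos.ne'⟩
  let σ : Representation K H V := (Units.coeHom (V →ₗ[K] V)).comp H.subtype
  let e : Subrepresentation ρ ≃o Subrepresentation σ :=
    { toFun := fun W ↦ ⟨W.toSubmodule, fun h v hv ↦ by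
        obtain ⟨g, hg⟩ := h.2
        have h' : σ h = ρ g := by
          change ((h : (V →ₗ[K] V)ˣ) : V →ₗ[K] V) = ρ g
          rw [← hg, Representation.asGroupHom_apply]
        rw [h']
        exact W.apply_mem_toSubmodule g hv⟩
      invFun := fun W ↦ ⟨W.toSubmodule, fun g v hv ↦ by
        have h' : ρ g = σ ⟨ρ.asGroupHom g, g, rfl⟩ := by
          change ρ g = ((ρ.asGroupHom g : (V →ₗ[K] V)ˣ) : V →ₗ[K] V)
          rw [Representation.asGroupHom_apply]
        rw [h']
        exact W.apply_mem_toSubmodule _ hv⟩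
      left_inv := fun W ↦ by ext; rfl
      right_inv := fun W ↦ by ext; rfl
      map_rel_iff' := Iff.rfl }
  exact e.complementedLattice_iff.mpr inferInstance

/-- **The subrepresentation on a `Γ`-stable `T ≤ V^U` is semisimple** (compact `Γ`, `U` open, char
`K` = 0, no continuity): `Γ` acts on `T` through the finite group `Γ/U'`.
[cite: Deligne1982HodgeCycles, §2 Prop. 2.9(b)] [cite: Serre1977, §1.3 Thm. 1] -/
theorem isSemisimpleRepresentation_toRepresentation_of_le_invariants_openSubgroup [CharZero K]
    (ρ : Representation K Γ V) (U : OpenSubgroup Γ) (T : Subrepresentation ρ)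
    (hT : T.toSubmodule ≤ Representation.invariants (ρ.comp (U : Subgroup Γ).subtype)) :
    T.toRepresentation.IsSemisimpleRepresentation :=
  isSemisimpleRepresentation_of_finite_range _
    (finite_range_restrict_of_le_invariants_openSubgroup ρ U hT fun g _ hv ↦
      T.apply_mem_toSubmodule g hv)

end Pure

/-! ## §2 `E` over a perfect field: `Γ_k` acts on `𝒯ᵖ(X)` through a finite quotient -/

namespace GaloisWeilCohomology

variable {k : Type u} [Field k] {K : Type v} [Field K] [CharZero K]
  {χ : Field.absoluteGaloisGroup k →* Kˣ} (E : GaloisWeilCohomology k K χ)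
variable {d : ℕ} {X : SchemeOver k}

/-- `Γ_k = Gal(k̄/k)` is compact for a perfect field `k` (`k̄/k` is then Galois; Krull topology,
Mathlib).  For an imperfect `k` Mathlib's compactness instance for `Aut(k̄/k)` is not available, whence
the standing hypothesis `[PerfectField k]` below (all finite fields and all fields of characteristic
`0`).  (PRIVATE local copy of the tree's
`Literature.NumberTheory.EllipticCurves.compactSpace_absoluteGaloisGroup` (`SelmerCorankProofs`), to
avoid the import.) [cite: SerreLocalFields1979, Ch. XIII §1] -/
private theorem compactSpace_absoluteGaloisGroup (k : Type u) [Field k] [PerfectField k] :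
    CompactSpace (Field.absoluteGaloisGroup k) := by
  haveI : IsGalois k (AlgebraicClosure k) := IsSepClosure.isGalois
  exact inferInstanceAs <| CompactSpace (AlgebraicClosure k ≃ₐ[k] AlgebraicClosure k)

/-- **An open NORMAL subgroup of `Γ_k` acts trivially on `𝒯ᵖ(X)`** and is exactly its pointwise
stabiliser (`X` smooth projective over any field): `Γ_k` acts on the Tate classes through the
group `Γ_k/U'` (finite when `Γ_k` is compact). [cite: Deligne1982HodgeCycles, §2 Prop. 2.9(b) «through a finite quotient»] [cite: Tate1994, §1] -/
theorem exists_openSubgroup_normal_tateClasses_eq_invariants (hX : IsSmoothProjective d X) (p : ℕ) :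
    ∃ U : OpenSubgroup (Field.absoluteGaloisGroup k),
      (U : Subgroup (Field.absoluteGaloisGroup k)).Normal ∧
      (∀ g : Field.absoluteGaloisGroup k, g ∈ U ↔
        ∀ x ∈ E.tateClasses X p, E.ρTwist X (2 * p) p g x = x) ∧
      E.tateClasses X p = Representation.invariants
        ((E.ρTwist X (2 * p) p).comp (U : Subgroup (Field.absoluteGaloisGroup k)).subtype) := by
  obtain ⟨U, hU⟩ := E.exists_openSubgroup_tateClasses_eq_invariants hX p
  obtain ⟨U', hN, -, hiff⟩ := exists_openSubgroup_normal_forall_apply_eq (E.ρTwist X (2 * p) p) U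
    hU.le fun g _ hx ↦ E.ρTwist_apply_mem_tateClasses X p g hx
  refine ⟨U', hN, hiff, le_antisymm (fun x hx ↦ ?_) fun x hx ↦ ?_⟩
  · rintro ⟨g, hg⟩
    exact (hiff g).mp hg x hx
  · exact (mem_smoothInvariants_iff _ x).mpr ⟨U', fun g hg ↦ hx ⟨g, hg⟩⟩

/-- **Every `χ(g)ᵖρ(g)` has finite order on `𝒯ᵖ(X)`** (`X` smooth projective over a perfect field,
no continuity): `(χ(g)ᵖρ(g))ⁿ = 1` on the Tate classes for some `n ≥ 1`.
[cite: Deligne1982HodgeCycles, §2 Prop. 2.9(b)] [cite: Tate1994, §1] -/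
theorem exists_pow_ρTwist_apply_eq_of_mem_tateClasses [PerfectField k] (hX : IsSmoothProjective d X) (p : ℕ)
    (g : Field.absoluteGaloisGroup k) :
    ∃ n : ℕ, 0 < n ∧ ∀ x ∈ E.tateClasses X p, (E.ρTwist X (2 * p) p g ^ n) x = x := by
  haveI := compactSpace_absoluteGaloisGroup k
  obtain ⟨U, hU⟩ := E.exists_openSubgroup_tateClasses_eq_invariants hX p
  obtain ⟨n, hn, h⟩ := exists_pow_apply_eq_of_mem_invariants_openSubgroup (E.ρTwist X (2 * p) p) U g
  exact ⟨n, hn, fun x hx ↦ h x (hU ▸ hx)⟩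

/-- **Every `χ(g)ᵖρ(g)` is a SEMISIMPLE endomorphism of `𝒯ᵖ(X)`** over any perfect field (`X` smooth
projective, char `K` = 0, no continuity) — row g39-#1's `isSemisimple_restrict_ρTwist_tateClasses`
without the finiteness of `k`. [cite: Deligne1982HodgeCycles, §2 Prop. 2.9(b)] [cite: Serre1977, §1.3 Thm. 1] -/
theorem isSemisimple_restrict_ρTwist_tateClasses_of_field [PerfectField k] (hX : IsSmoothProjective d X) (p : ℕ)
    (g : Field.absoluteGaloisGroup k) :
    Module.End.IsSemisimple ((E.ρTwist X (2 * p) p g).restrict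
      fun _ hx ↦ E.ρTwist_apply_mem_tateClasses X p g hx) := by
  haveI := compactSpace_absoluteGaloisGroup k
  obtain ⟨U, hU⟩ := E.exists_openSubgroup_tateClasses_eq_invariants hX p
  exact isSemisimple_restrict_of_le_invariants_openSubgroup _ U g hU.le _

/-- **The image of `Γ_k` in `End(𝒯ᵖ(X))` is finite** over any perfect field (`X` smooth projective, no
continuity of `ρ`) — row g39-#2's `finite_range_restrict_ρTwist_tateClasses` without the finiteness of
`k`. [cite: Deligne1982HodgeCycles, §2 Prop. 2.9(b) «through a finite quotient»] [cite: Tate1994, §1] -/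
theorem finite_range_restrict_ρTwist_tateClasses_of_field [PerfectField k] (hX : IsSmoothProjective d X) (p : ℕ) :
    (Set.range fun g : Field.absoluteGaloisGroup k ↦
      (E.ρTwist X (2 * p) p g).restrict
        (fun _ hx ↦ E.ρTwist_apply_mem_tateClasses X p g hx)).Finite := by
  haveI := compactSpace_absoluteGaloisGroup k
  obtain ⟨U, hU⟩ := E.exists_openSubgroup_tateClasses_eq_invariants hX p
  exact finite_range_restrict_of_le_invariants_openSubgroup _ U hU.le _

/-- **The `Γ_k`-module `𝒯ᵖ(X)` is semisimple over any perfect field** (`X` smooth projective, char `K` = 0,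
no continuity of `ρ`): `Γ_k` acts through a finite quotient, and Maschke — row g39-#2's
`isSemisimpleRepresentation_tateClasses` without the finiteness of `k`.
[cite: Deligne1982HodgeCycles, §2 Prop. 2.9(b)] [cite: Serre1977, §1.3 Thm. 1] [cite: Tate1994, §1] -/
theorem isSemisimpleRepresentation_tateClasses_of_field [PerfectField k] (hX : IsSmoothProjective d X) (p : ℕ) :
    (Subrepresentation.toRepresentation
        (⟨E.tateClasses X p, fun g _ hx ↦ E.ρTwist_apply_mem_tateClasses X p g hx⟩ :
          Subrepresentation (E.ρTwist X (2 * p) p))).IsSemisimpleRepresentation := by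
  haveI := compactSpace_absoluteGaloisGroup k
  obtain ⟨U, hU⟩ := E.exists_openSubgroup_tateClasses_eq_invariants hX p
  exact isSemisimpleRepresentation_toRepresentation_of_le_invariants_openSubgroup _ U _ hU.le

/-- **Every `Γ_k`-stable subspace of `𝒯ᵖ(X)` has a `Γ_k`-stable complement inside `𝒯ᵖ(X)`** over any
perfect field (`X` smooth projective, char `K` = 0, no continuity of `ρ`).
[cite: Deligne1982HodgeCycles, §2 Prop. 2.9(b)] [cite: Serre1977, §1.3 Thm. 1] [cite: Tate1994, §1] -/
theorem exists_galois_stable_compl_of_le_tateClasses_of_field [PerfectField k] (hX : IsSmoothProjective d X) (p : ℕ)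
    {W : Submodule K (E.obj X (2 * p))} (hW : W ≤ E.tateClasses X p)
    (hΓ : ∀ g : Field.absoluteGaloisGroup k, ∀ x ∈ W, E.ρTwist X (2 * p) p g x ∈ W) :
    ∃ W' ≤ E.tateClasses X p,
      (∀ g : Field.absoluteGaloisGroup k, ∀ x ∈ W', E.ρTwist X (2 * p) p g x ∈ W') ∧
      Disjoint W W' ∧ W ⊔ W' = E.tateClasses X p := by
  set T : Subrepresentation (E.ρTwist X (2 * p) p) :=
    ⟨E.tateClasses X p, fun g _ hx ↦ E.ρTwist_apply_mem_tateClasses X p g hx⟩ with hT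
  have hss := E.isSemisimpleRepresentation_tateClasses_of_field hX p
  -- `W` read inside `𝒯ᵖ(X)` as a subrepresentation of `T.toRepresentation`
  let Wc : Subrepresentation T.toRepresentation :=
    ⟨W.comap (E.tateClasses X p).subtype, fun g v hv ↦ hΓ g _ hv⟩
  obtain ⟨Q, hWQ⟩ := hss.exists_isCompl Wc
  refine ⟨Q.toSubmodule.map (E.tateClasses X p).subtype, ?_, ?_, ?_, ?_⟩
  · rintro _ ⟨y, -, rfl⟩
    exact y.2
  · rintro g _ ⟨y, hy, rfl⟩
    exact ⟨T.toRepresentation g y, Q.apply_mem_toSubmodule g hy, rfl⟩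
  · rw [disjoint_iff, Submodule.eq_bot_iff]
    rintro x ⟨hxW, ⟨y, hy, rfl⟩⟩
    have hyW : y ∈ Wc.toSubmodule := hxW
    have h0 : y ∈ (Wc ⊓ Q).toSubmodule := ⟨hyW, hy⟩
    rw [hWQ.inf_eq_bot] at h0
    rw [(Submodule.mem_bot K).mp h0, map_zero]
  · refine le_antisymm (sup_le hW ?_) fun x hx ↦ ?_
    · rintro _ ⟨y, -, rfl⟩
      exact y.2
    · have htop : (⟨x, hx⟩ : E.tateClasses X p) ∈ (Wc ⊔ Q).toSubmodule := by
        rw [hWQ.sup_eq_top]; exact Submodule.mem_top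
      obtain ⟨a, ha, b, hb, hab⟩ := Submodule.mem_sup.mp htop
      rw [Submodule.mem_sup]
      refine ⟨(a : E.obj X (2 * p)), ha, (b : E.obj X (2 * p)), ⟨b, hb, rfl⟩, ?_⟩
      rw [← Submodule.coe_add, hab]

end GaloisWeilCohomology

end Literature.AlgebraicGeometry.Motives

end
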